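import Literature.NumberTheory.GaloisRepresentations.WeilLAdicCharacterLocalShape
import HarnessLib

/-!
# The algebraic part `Λ = ∏_{(w,e)} e(x_w)^{-n_{(w,e)}}` of a `p`-adic avatar at a SPLIT prime of a
# quadratic field: two local embeddings, exponents `p_∞` at the `ι`-place `v` and `q_∞` at `v̄`

For a Hecke character of infinity type `(p, q)` over a number field `K` and `ι : ℚ̄_ℓ ≃ ℂ`, the idelic
`ℓ`-adic avatar is `ψ_ℓ(x) = ι⁻¹(χ(x) A(x_∞)⁻¹) · Λ(x)`, `Λ(x) = ∏_{(w,e) : w ∣ ℓ, e : K_w → ℚ̄_ℓ} e(x_w)^{−n_{ι∘e∘ι_w}}`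
(`PadicEmbedding.algPart`, Serre II §2.7 / Weil 1956). When `K` is quadratic with a COMPLEX place `w_∞`
and `ℓ = v v̄` SPLITS, with `v` the place induced by `ι` — `k ∈ 𝔭_v ⟺ |ι⁻¹(σ_{w_∞}(k))|_ℓ < 1`, the
hypothesis under which de Shalit's / Katz's two-variable measure is stated in the tree
(`DeShalit1987.thmII414_exists_lMeasure`, `KatzPAdicLFunction`) — there are exactly two local embeddings,
one above `v` and one above `v̄`, each unique (`K_v = K_v̄ = ℚ_ℓ`), and their exponents are `p_{w_∞}`
(the embedding `σ_{w_∞}` factors through `v`) and `q_{w_∞}` (its conjugate factors through `v̄`):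

* `localDatum`, `placeEmb_univ_eq_pair` — `PlaceEmb K ℓ = {(v, e₁), (v̄, e₂)}` for ANY continuous `e₁ : K_v → ℚ̄_ℓ`,
  `e₂ : K_v̄ → ℚ̄_ℓ` (so each is THE local embedding);
* `comp_toEmbedding_eq_embedding` / `…_eq_conjugate` — `ι ∘ e₁ ∘ ι_v = σ_{w_∞}`, `ι ∘ e₂ ∘ ι_v̄ = σ̄_{w_∞}`;
  `exponent_localDatum_fst` / `exponent_localDatum_snd` — `n_{(v,e₁)} = p_{w_∞}`, `n_{(v̄,e₂)} = q_{w_∞}`;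
* ★ `coe_algPart_eq_of_split` — **`Λ(x) = e₁(x_v)^{−p_{w_∞}} · e₂(x_v̄)^{−q_{w_∞}}`**.

This pins the exponents (hence the signs) in de Shalit's reading `ε̂|_{Gal(K̄/K(𝔣))} = χ·κ^{∓k}λ^{±j}` of a
Grössencharacter of type `(k, j)` (II.4.13–4.14), consumed with `avatarValueAt_eq_of_mem_ker_rayClassField`
(`HeckeCharacterRayKernelAvatar.lean`). Theorems only; no `sorry`.

## References
* [SerreAbelianLadic1968] J.-P. Serre, *Abelian ℓ-adic representations…* (1968), Ch. II §2.7, §3.1.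
* [Weil1956] A. Weil, *On a certain type of characters of the idèle-class group…* (1956), §1.
* [deShalit1987] E. de Shalit, *Iwasawa theory of elliptic curves with complex multiplication* (1987),
  II.1.1 (p. 32), II.4.13 (p. 69), II.4.14 (36) (p. 71).
-/

noncomputable section

open scoped NumberField Classical
open NumberField IsDedekindDomain IsDedekindDomain.HeightOneSpectrum Field

namespace Literature.NumberTheory.GaloisRepresentations

namespace PadicEmbedding

open HeckeCharacter

variable {K : Type} [Field K] [NumberField K] {ℓ : ℕ} [Fact ℓ.Prime]

/-! ### §1. Generalities: the place of `ι⁻¹ ∘ σ`, cardinality of `PlaceEmb` -/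

/-- `#PlaceEmb K ℓ = [K : ℚ]` (bijection with the embeddings `K → ℚ̄_ℓ`). [cite: SerreAbelianLadic1968, Ch. II §3.1] -/
theorem card_placeEmb : Fintype.card (PlaceEmb K ℓ) = Module.finrank ℚ K := by
  rw [Fintype.card_congr (placeEmbEquiv K ℓ), NumberField.Embeddings.card]

/-- **The place of `ι⁻¹ ∘ σ_w` is `v` when `v` is the place induced by `ι`** (the tree's hypothesis
`k ∈ 𝔭_v ⟺ |ι⁻¹(σ_w(k))| < 1`). [cite: deShalit1987, II.1.1 (p. 32)] [cite: SerreAbelianLadic1968, Ch. II §3.1] -/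
theorem place_symm_comp_embedding_eq (ι : PadicAlgCl ℓ ≃+* ℂ) {w : InfinitePlace K}
    {v : HeightOneSpectrum (𝓞 K)}
    (hι : ∀ k : 𝓞 K, k ∈ v.asIdeal ↔ ‖ι.symm (w.embedding (k : K))‖ < 1) :
    place ((ι.symm : ℂ →+* PadicAlgCl ℓ).comp w.embedding) = v := by
  refine HeightOneSpectrum.ext (Ideal.ext fun k ↦ ?_)
  change k ∈ ideal ((ι.symm : ℂ →+* PadicAlgCl ℓ).comp w.embedding) ↔ k ∈ v.asIdeal
  rw [mem_ideal_iff, hι k]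
  rfl

/-- In a quadratic field with a complex place `w`, every complex embedding is `σ_w` or `σ̄_w`.
[cite: Weil1956, §1] -/
theorem embedding_eq_or_eq_conjugate (hK2 : Module.finrank ℚ K = 2) {w : InfinitePlace K}
    (hw : w.IsComplex) (φ : K →+* ℂ) :
    φ = w.embedding ∨ φ = ComplexEmbedding.conjugate w.embedding := by
  classical
  by_contra h
  rw [not_or] at h
  have hne : w.embedding ≠ ComplexEmbedding.conjugate w.embedding := fun heq ↦
    (InfinitePlace.isComplex_iff.mp hw) (ComplexEmbedding.isReal_iff.mpr heq.symm)
  have hcard : ({φ, w.embedding, ComplexEmbedding.conjugate w.embedding} : Finset (K →+* ℂ)).card = 3 := by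
    rw [Finset.card_insert_of_notMem (by simp [h.1, h.2]), Finset.card_pair hne]
  have hle : ({φ, w.embedding, ComplexEmbedding.conjugate w.embedding} : Finset (K →+* ℂ)).card ≤
      Fintype.card (K →+* ℂ) := Finset.card_le_univ _
  rw [hcard, NumberField.Embeddings.card, hK2] at hle
  omega

/-! ### §2. The two local embeddings at a split prime -/

section Split

variable {w : InfinitePlace K} {v vbar : HeightOneSpectrum (𝓞 K)}
  {e₁ : v.adicCompletion K →+* PadicAlgCl ℓ} {e₂ : vbar.adicCompletion K →+* PadicAlgCl ℓ}

/-- The local embedding datum `(v, e)`. [folklore] -/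
def localDatum (hv : ((ℓ : ℕ) : 𝓞 K) ∈ v.asIdeal) {e : v.adicCompletion K →+* PadicAlgCl ℓ}
    (he : Continuous e) : PlaceEmb K ℓ :=
  ⟨⟨v, hv⟩, ⟨e, he⟩⟩

/-- The place of `(v, e)` is `v`. [cite: SerreAbelianLadic1968, Ch. II §3.1] -/
@[simp] theorem localDatum_fst (hv : ((ℓ : ℕ) : 𝓞 K) ∈ v.asIdeal) {e : v.adicCompletion K →+* PadicAlgCl ℓ}
    (he : Continuous e) : ((localDatum hv he).1 : HeightOneSpectrum (𝓞 K)) = v := rfl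

/-- Data above distinct places are distinct. [cite: SerreAbelianLadic1968, Ch. II §3.1] -/
theorem localDatum_ne (hv : ((ℓ : ℕ) : 𝓞 K) ∈ v.asIdeal) (hvbar : ((ℓ : ℕ) : 𝓞 K) ∈ vbar.asIdeal)
    (hne : vbar ≠ v) (he₁ : Continuous e₁) (he₂ : Continuous e₂) :
    localDatum hv he₁ ≠ localDatum hvbar he₂ := fun h ↦
  hne.symm (congrArg (fun P : PlaceEmb K ℓ ↦ (P.1 : HeightOneSpectrum (𝓞 K))) h)

/-- **`PlaceEmb K ℓ = {(v, e₁), (v̄, e₂)}`** at a split prime of a quadratic field, for ANY continuous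
local embeddings `e₁`, `e₂` (two distinct elements in a set of cardinality `[K:ℚ] = 2`).
[cite: SerreAbelianLadic1968, Ch. II §3.1] [cite: deShalit1987, II.1.1 (p. 32)] -/
theorem placeEmb_univ_eq_pair (hK2 : Module.finrank ℚ K = 2) (hv : ((ℓ : ℕ) : 𝓞 K) ∈ v.asIdeal)
    (hvbar : ((ℓ : ℕ) : 𝓞 K) ∈ vbar.asIdeal) (hne : vbar ≠ v) (he₁ : Continuous e₁)
    (he₂ : Continuous e₂) :
    (Finset.univ : Finset (PlaceEmb K ℓ)) = {localDatum hv he₁, localDatum hvbar he₂} := by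
  refine (Finset.eq_univ_of_card _ ?_).symm
  rw [Finset.card_pair (localDatum_ne hv hvbar hne he₁ he₂), card_placeEmb, hK2]

/-- Every local embedding datum is `(v, e₁)` or `(v̄, e₂)`. [cite: SerreAbelianLadic1968, Ch. II §3.1] -/
theorem placeEmb_eq_or_eq (hK2 : Module.finrank ℚ K = 2) (hv : ((ℓ : ℕ) : 𝓞 K) ∈ v.asIdeal)
    (hvbar : ((ℓ : ℕ) : 𝓞 K) ∈ vbar.asIdeal) (hne : vbar ≠ v) (he₁ : Continuous e₁)
    (he₂ : Continuous e₂) (P : PlaceEmb K ℓ) : P = localDatum hv he₁ ∨ P = localDatum hvbar he₂ := by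
  have h := Finset.mem_univ P
  rw [placeEmb_univ_eq_pair hK2 hv hvbar hne he₁ he₂, Finset.mem_insert, Finset.mem_singleton] at h
  exact h

/-- **`ι ∘ e₁ ∘ ι_v = σ_w`**: the global embedding through `v` is the distinguished complex embedding
(read through `ι`) — `ι⁻¹ ∘ σ_w` has place `v`, and `(v, e₁)` is the only datum above `v`.
[cite: deShalit1987, II.1.1 (p. 32)] [cite: SerreAbelianLadic1968, Ch. II §3.1] -/
theorem comp_toEmbedding_eq_embedding (hK2 : Module.finrank ℚ K = 2) (ι : PadicAlgCl ℓ ≃+* ℂ)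
    (hv : ((ℓ : ℕ) : 𝓞 K) ∈ v.asIdeal) (hvbar : ((ℓ : ℕ) : 𝓞 K) ∈ vbar.asIdeal) (hne : vbar ≠ v)
    (hι : ∀ k : 𝓞 K, k ∈ v.asIdeal ↔ ‖ι.symm (w.embedding (k : K))‖ < 1)
    (he₁ : Continuous e₁) (he₂ : Continuous e₂) :
    (ι : PadicAlgCl ℓ →+* ℂ).comp (localDatum hv he₁).toEmbedding = w.embedding := by
  set τ : K →+* PadicAlgCl ℓ := (ι.symm : ℂ →+* PadicAlgCl ℓ).comp w.embedding with hτ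
  have hplace : place τ = v := place_symm_comp_embedding_eq ι hι
  -- `ofEmbedding τ` lies above `v`, hence is `(v, e₁)`
  have hP : PlaceEmb.ofEmbedding τ = localDatum hv he₁ := by
    rcases placeEmb_eq_or_eq hK2 hv hvbar hne he₁ he₂ (PlaceEmb.ofEmbedding τ) with h | h
    · exact h
    · exfalso
      have h1 : ((PlaceEmb.ofEmbedding τ).1 : HeightOneSpectrum (𝓞 K)) = vbar :=
        congrArg (fun P : PlaceEmb K ℓ ↦ (P.1 : HeightOneSpectrum (𝓞 K))) h
      rw [PlaceEmb.ofEmbedding_fst, hplace] at h1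
      exact hne h1.symm
  have hemb : (localDatum hv he₁).toEmbedding = τ := by
    rw [← hP, PlaceEmb.toEmbedding_ofEmbedding]
  rw [hemb, hτ, ← RingHom.comp_assoc]
  ext k
  simp

/-- **`ι ∘ e₂ ∘ ι_v̄ = σ̄_w`**: the global embedding through `v̄` is the conjugate embedding.
[cite: deShalit1987, II.1.1 (p. 32)] [cite: Weil1956, §1] -/
theorem comp_toEmbedding_eq_conjugate (hK2 : Module.finrank ℚ K = 2) (hw : w.IsComplex)
    (ι : PadicAlgCl ℓ ≃+* ℂ) (hv : ((ℓ : ℕ) : 𝓞 K) ∈ v.asIdeal) (hvbar : ((ℓ : ℕ) : 𝓞 K) ∈ vbar.asIdeal)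
    (hne : vbar ≠ v) (hι : ∀ k : 𝓞 K, k ∈ v.asIdeal ↔ ‖ι.symm (w.embedding (k : K))‖ < 1)
    (he₁ : Continuous e₁) (he₂ : Continuous e₂) :
    (ι : PadicAlgCl ℓ →+* ℂ).comp (localDatum hvbar he₂).toEmbedding =
      ComplexEmbedding.conjugate w.embedding := by
  rcases embedding_eq_or_eq_conjugate hK2 hw
    ((ι : PadicAlgCl ℓ →+* ℂ).comp (localDatum hvbar he₂).toEmbedding) with h | h
  · exfalso
    have h1 := comp_toEmbedding_eq_embedding hK2 ι hv hvbar hne hι he₁ he₂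
    rw [← h] at h1
    have h2 : (localDatum hv he₁).toEmbedding = (localDatum hvbar he₂).toEmbedding := by
      have h3 := congrArg (fun f : K →+* ℂ ↦ (ι.symm : ℂ →+* PadicAlgCl ℓ).comp f) h1
      simp only [← RingHom.comp_assoc] at h3
      ext k
      have h4 := RingHom.congr_fun h3 k
      simpa using h4
    have h3 : localDatum hv he₁ = localDatum hvbar he₂ := PlaceEmb.toEmbedding_bijective.1 h2
    exact localDatum_ne hv hvbar hne he₁ he₂ h3
  · exact h

/-- **Exponent `p_w` above `v`.** [cite: Weil1956, §1] [cite: deShalit1987, II.4.13 (p. 69)] -/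
theorem exponent_localDatum_fst (hK2 : Module.finrank ℚ K = 2) (hw : w.IsComplex)
    (ι : PadicAlgCl ℓ ≃+* ℂ) (hv : ((ℓ : ℕ) : 𝓞 K) ∈ v.asIdeal) (hvbar : ((ℓ : ℕ) : 𝓞 K) ∈ vbar.asIdeal)
    (hne : vbar ≠ v) (hι : ∀ k : 𝓞 K, k ∈ v.asIdeal ↔ ‖ι.symm (w.embedding (k : K))‖ < 1)
    (he₁ : Continuous e₁) (he₂ : Continuous e₂) (p q : InfinitePlace K → ℤ) :
    (localDatum hv he₁).exponent ι p q = p w := by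
  rw [PlaceEmb.exponent, comp_toEmbedding_eq_embedding hK2 ι hv hvbar hne hι he₁ he₂, embExponent,
    if_neg (InfinitePlace.isComplex_iff.mp hw), InfinitePlace.mk_embedding, if_pos rfl]

/-- **Exponent `q_w` above `v̄`.** [cite: Weil1956, §1] [cite: deShalit1987, II.4.13 (p. 69)] -/
theorem exponent_localDatum_snd (hK2 : Module.finrank ℚ K = 2) (hw : w.IsComplex)
    (ι : PadicAlgCl ℓ ≃+* ℂ) (hv : ((ℓ : ℕ) : 𝓞 K) ∈ v.asIdeal) (hvbar : ((ℓ : ℕ) : 𝓞 K) ∈ vbar.asIdeal)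
    (hne : vbar ≠ v) (hι : ∀ k : 𝓞 K, k ∈ v.asIdeal ↔ ‖ι.symm (w.embedding (k : K))‖ < 1)
    (he₁ : Continuous e₁) (he₂ : Continuous e₂) (p q : InfinitePlace K → ℤ) :
    (localDatum hvbar he₂).exponent ι p q = q w := by
  have hnr : ¬ ComplexEmbedding.IsReal (ComplexEmbedding.conjugate w.embedding) := by
    rw [ComplexEmbedding.isReal_conjugate_iff]
    exact InfinitePlace.isComplex_iff.mp hw
  have hne' : ComplexEmbedding.conjugate w.embedding ≠ w.embedding := fun heq ↦
    (InfinitePlace.isComplex_iff.mp hw) (ComplexEmbedding.isReal_iff.mpr heq)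
  rw [PlaceEmb.exponent, comp_toEmbedding_eq_conjugate hK2 hw ι hv hvbar hne hι he₁ he₂, embExponent,
    if_neg hnr, InfinitePlace.mk_conjugate_eq, InfinitePlace.mk_embedding, if_neg hne']

/-- ★ **`Λ(x) = e₁(x_v)^{−p_w} · e₂(x_v̄)^{−q_w}` at a split prime of a quadratic field** (`w` its complex
place, `v` the place induced by `ι`, `v̄ ≠ v` the other place above `ℓ`, `e₁`, `e₂` ANY continuous local
embeddings — each is unique): the algebraic part of the `ℓ`-adic avatar of a Hecke character of type
`(p, q)` reads the `v`-component with exponent `p_w` and the `v̄`-component with exponent `q_w`.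
[cite: SerreAbelianLadic1968, Ch. II §2.7] [cite: Weil1956, §1] [cite: deShalit1987, II.4.13 (p. 69), II.4.14 (36) (p. 71)] -/
theorem coe_algPart_eq_of_split (hK2 : Module.finrank ℚ K = 2) (hw : w.IsComplex)
    (ι : PadicAlgCl ℓ ≃+* ℂ) (hv : ((ℓ : ℕ) : 𝓞 K) ∈ v.asIdeal) (hvbar : ((ℓ : ℕ) : 𝓞 K) ∈ vbar.asIdeal)
    (hne : vbar ≠ v) (hι : ∀ k : 𝓞 K, k ∈ v.asIdeal ↔ ‖ι.symm (w.embedding (k : K))‖ < 1)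
    (he₁ : Continuous e₁) (he₂ : Continuous e₂) (p q : InfinitePlace K → ℤ) (x : ideleGroup K) :
    (algPart ι p q x : PadicAlgCl ℓ) =
      e₁ ((x : AdeleRing (𝓞 K) K).2 v) ^ (-p w) * e₂ ((x : AdeleRing (𝓞 K) K).2 vbar) ^ (-q w) := by
  rw [algPart_apply, placeEmb_univ_eq_pair hK2 hv hvbar hne he₁ he₂,
    Finset.prod_pair (localDatum_ne hv hvbar hne he₁ he₂), Units.val_mul, Units.val_zpow_eq_zpow_val,
    Units.val_zpow_eq_zpow_val, PlaceEmb.coe_eval, PlaceEmb.coe_eval,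
    exponent_localDatum_fst hK2 hw ι hv hvbar hne hι he₁ he₂,
    exponent_localDatum_snd hK2 hw ι hv hvbar hne hι he₁ he₂]
  rfl

end Split

end PadicEmbedding

end Literature.NumberTheory.GaloisRepresentations

end
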